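import Summits.QuantumFields.YangMills.Theorems.PoincareLipschitzSamplingCells
import Literature.Analysis.FunctionSpaces.SobolevDomainProofs
import Mathlib.Analysis.InnerProductSpace.PiL2
import Mathlib.MeasureTheory.Integral.Bochner.Set
import Mathlib.MeasureTheory.Measure.Haar.InnerProductSpace
import HarnessLib

/-!
# LINE 25 «CompactnessTransfer» (K2 crux `BlockLipschitzL` stmt-QuantumFields-23533 ∕ crux of record `HistoryTailL` stmt-QuantumFields-19936), S2♭″ (Γ-KNIT) —
# FILE (S) «SOBOLEV LETTERS»: the four facts about weak gradients on the cube that the knit consumes — (i) the EVERYWHERE-UNIT REPRESENTATIVE of an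
# a.e.-unit a.e.-strongly-measurable map and the a.e.-CONGRUENCE of `HasWeakFDerivOn` in the function slot, (ii) LOCALITY: two maps that agree on an open
# `Ω' ⊆ Ω` have a.e.-equal weak gradients on `Ω'` (lit ✓`HasWeakFDerivOn.mono_set_holds` + ✓`unique_holds`), (iii) the OUTER IDENTITY on the cube: if the
# densities agree a.e. off `Q_{s₃}` and compare on `Q_{s₃}`, they compare on `Q`, (iv) the MONOTONE LIMIT `∫_{Q_{s₁}} f → ∫_{Q_{s₃}} f` as `s₁ ↑ s₃` in the form
# «a bound on all `Q_{s₁}`, `s₀ < s₁ < s₃`, is a bound on `Q_{s₃}`» (no boundary-null lemma needed).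

Cell `ym3-torus` (YM ladder rung R3 = continuum SU(2) Yang–Mills on T³ — a RUNG, NOT the Clay problem: not d = 4, not infinite volume, not a mass gap);
width seat `ym3-torus-px3` gen 8 (the Γ-KNIT pen, LEAD ★w1-19936 g10 12:29:32Z S2♭″ ARCHITECTURE v0).  THEOREMS ONLY (0 `def`, 0 `sorry`, default heartbeats);
`--supports stmt-QuantumFields-23533 --as helper`.  Generic in the measure ∕ spaces where free; cube letters over ✓`PoincareLipschitzSamplingCells.isOpen_absCube`.
HONEST SCOPE.  Letters for the knit; S2♭″, S1″, `hHalvingBand`, K1, `MeanDeviationL`, `BlockLipschitzL`, `HistoryTailL` are NOT proved here; YM gap NOT proved.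

References: L. C. Evans, Partial Differential Equations, 2nd ed. (2010), §5.2.1 (weak derivatives: definition, uniqueness, locality) [Evans2010];
L. Simon, Theorems on Regularity and Singularity of Energy Minimizing Maps (1996) §2.9 [Simon1996].
-/

set_option autoImplicit false

noncomputable section

open scoped BigOperators
open MeasureTheory Set Filter Topology TopologicalSpace

namespace Summit.QuantumFields.YangMills.Theorems.PoincareLipschitzLatticeToContinuumSobolevLetters

open Literature.Analysis.FunctionSpaces (HasWeakFDerivOn IsTestFunctionOn)
open Summit.QuantumFields.YangMills.Theorems.PoincareLipschitzSamplingCells (isOpen_absCube)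

/-! ## §1 The everywhere-unit representative and a.e.-congruence of weak gradients -/

/-- ★ **THE EVERYWHERE-UNIT REPRESENTATIVE.**  An a.e.-strongly measurable map which is unit a.e. (w.r.t. `μ`) agrees `μ`-a.e. with a MEASURABLE map which is
unit EVERYWHERE (modify on the null set to a fixed unit vector). [folklore] -/
theorem exists_unit_representative {X : Type*} [MeasurableSpace X] {μ : Measure X}
    (U₀ : X → EuclideanSpace ℝ (Fin 4)) (hm : AEStronglyMeasurable U₀ μ) (h1 : ∀ᵐ x ∂μ, ‖U₀ x‖ = 1) :
    ∃ U : X → EuclideanSpace ℝ (Fin 4), Measurable U ∧ (∀ x, ‖U x‖ = 1) ∧ (∀ᵐ x ∂μ, U x = U₀ x) := by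
  classical
  set V := hm.mk U₀ with hV
  have hVm : StronglyMeasurable V := hm.stronglyMeasurable_mk
  set e₀ : EuclideanSpace ℝ (Fin 4) := EuclideanSpace.single 0 1 with he₀
  have he₀1 : ‖e₀‖ = 1 := by rw [he₀]; simp
  refine ⟨fun x => if ‖V x‖ = 1 then V x else e₀, ?_, ?_, ?_⟩
  · refine Measurable.ite ?_ hVm.measurable measurable_const
    exact hVm.measurable.norm (measurableSet_singleton (1 : ℝ))
  · intro x
    by_cases hx : ‖V x‖ = 1
    · simp only [hx, if_true]
    · simp only [hx, if_false, he₀1]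
  · filter_upwards [hm.ae_eq_mk, h1] with x hx hx1
    have hVx : V x = U₀ x := hx.symm
    have h1' : ‖V x‖ = 1 := by rw [hVx, hx1]
    rw [if_pos h1', hVx]

/-- ★ **A.E.-CONGRUENCE OF `HasWeakFDerivOn` IN THE FUNCTION SLOT.**  If `g` is a weak gradient of `f` on `Ω` and `f' = f` `μ`-a.e. on `Ω`, then `g` is a weak
gradient of `f'` on `Ω` (Evans §5.2.1: weak derivatives see `f` only through integrals). [cite: Evans2010, §5.2.1] -/
theorem hasWeakFDerivOn_congr_ae {E' : Type*} [NormedAddCommGroup E'] [NormedSpace ℝ E'] [MeasurableSpace E']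
    {F : Type*} [NormedAddCommGroup F] [NormedSpace ℝ F]
    {Ω : Opens E'} {μ : Measure E'} {f f' : E' → F} {g : E' → E' →L[ℝ] F}
    (h : HasWeakFDerivOn Ω μ f g) (hff' : f' =ᵐ[μ.restrict (Ω : Set E')] f) : HasWeakFDerivOn Ω μ f' g := by
  refine ⟨h.locallyIntegrableOn.congr hff'.symm, h.locallyIntegrableOn_deriv, fun φ v hφ => ?_⟩
  rw [← h.integral_fderiv_smul_eq φ v hφ]
  refine integral_congr_ae ?_
  filter_upwards [hff'] with x hx
  rw [hx]

/-! ## §2 Locality of weak gradients -/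

/-- ★ **LOCALITY.**  If `U` has weak gradient `G` and `V` has weak gradient `GV` on `Ω`, and `V = U` on an open `Ω' ⊆ Ω`, then `GV = G` `μ`-a.e. on `Ω'`
(restrict both to `Ω'` by lit ✓`mono_set_holds`, transport `V`'s identity to `U` pointwise on `Ω'`, conclude by lit ✓`unique_holds`). [cite: Evans2010, §5.2.1] -/
theorem weakFDeriv_ae_eq_of_eqOn {E' : Type*} [NormedAddCommGroup E'] [NormedSpace ℝ E'] [MeasurableSpace E'] [FiniteDimensional ℝ E'] [BorelSpace E']
    {F : Type*} [NormedAddCommGroup F] [NormedSpace ℝ F] [CompleteSpace F]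
    {Ω Ω' : Opens E'} {μ : Measure E'} {U V : E' → F} {G GV : E' → E' →L[ℝ] F}
    (hU : HasWeakFDerivOn Ω μ U G) (hV : HasWeakFDerivOn Ω μ V GV) (hΩ : Ω' ≤ Ω) (hVU : ∀ x ∈ (Ω' : Set E'), V x = U x) :
    GV =ᵐ[μ.restrict (Ω' : Set E')] G := by
  have hU' := Literature.Analysis.FunctionSpaces.HasWeakFDerivOn.mono_set_holds hU hΩ
  have hV' := Literature.Analysis.FunctionSpaces.HasWeakFDerivOn.mono_set_holds hV hΩ
  have hV'' : HasWeakFDerivOn Ω' μ U GV := by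
    refine ⟨hU'.locallyIntegrableOn, hV'.locallyIntegrableOn_deriv, fun φ v hφ => ?_⟩
    rw [← hV'.integral_fderiv_smul_eq φ v hφ]
    exact setIntegral_congr_fun Ω'.isOpen.measurableSet fun x hx => by rw [hVU x hx]
  exact Literature.Analysis.FunctionSpaces.HasWeakFDerivOn.unique_holds hV'' hU'

/-- The set `{x ∈ Q | ∃ i, s < |xᵢ|}` (the open cube minus a closed concentric sub-cube) is open. [folklore] -/
theorem isOpen_absCube_sdiff (s : ℝ) :
    IsOpen {x : EuclideanSpace ℝ (Fin 3) | (∀ i : Fin 3, |x i| < 1) ∧ ∃ i : Fin 3, s < |x i|} := by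
  have h2 : IsOpen {x : EuclideanSpace ℝ (Fin 3) | ∃ i : Fin 3, s < |x i|} := by
    have : {x : EuclideanSpace ℝ (Fin 3) | ∃ i : Fin 3, s < |x i|} = ⋃ i : Fin 3, {x | s < |x i|} := by ext x; simp
    rw [this]
    exact isOpen_iUnion fun i => isOpen_lt continuous_const ((EuclideanSpace.proj i).continuous.abs)
  exact (isOpen_absCube 1).inter h2

/-- ★ **LOCALITY ON THE CUBE, IN S2♭″'s LETTERS.**  For the open unit cube `Q`, a competitor `V` agreeing with `U` wherever `∃ i, s ≤ |xᵢ|`, with weak gradients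
`GV`, `G` on `Q`: the Dirichlet densities agree a.e. on `Q ∖ Q_{s₃}` for every `s₃ > s`. [cite: Evans2010, §5.2.1] -/
theorem dens_ae_eq_off_subcube (hQ : IsOpen {x : EuclideanSpace ℝ (Fin 3) | ∀ i : Fin 3, |x i| < 1})
    {U V : EuclideanSpace ℝ (Fin 3) → EuclideanSpace ℝ (Fin 4)}
    {G GV : EuclideanSpace ℝ (Fin 3) → (EuclideanSpace ℝ (Fin 3) →L[ℝ] EuclideanSpace ℝ (Fin 4))}
    (hU : HasWeakFDerivOn ⟨{x : EuclideanSpace ℝ (Fin 3) | ∀ i : Fin 3, |x i| < 1}, hQ⟩ volume U G)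
    (hV : HasWeakFDerivOn ⟨{x : EuclideanSpace ℝ (Fin 3) | ∀ i : Fin 3, |x i| < 1}, hQ⟩ volume V GV)
    {s : ℝ} (hVU : ∀ x : EuclideanSpace ℝ (Fin 3), (∃ i : Fin 3, s ≤ |x i|) → V x = U x) {s₃ : ℝ} (hs : s < s₃) :
    ∀ᵐ x ∂(volume.restrict ({x : EuclideanSpace ℝ (Fin 3) | ∀ i : Fin 3, |x i| < 1} \ {x | ∀ i : Fin 3, |x i| < s₃})),
      (∑ i : Fin 3, ‖GV x (EuclideanSpace.single i (1:ℝ))‖ ^ 2) = ∑ i : Fin 3, ‖G x (EuclideanSpace.single i (1:ℝ))‖ ^ 2 := by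
  set Ω' : Opens (EuclideanSpace ℝ (Fin 3)) := ⟨{x | (∀ i : Fin 3, |x i| < 1) ∧ ∃ i : Fin 3, s < |x i|}, isOpen_absCube_sdiff s⟩ with hΩ'
  have hle : Ω' ≤ ⟨{x : EuclideanSpace ℝ (Fin 3) | ∀ i : Fin 3, |x i| < 1}, hQ⟩ := fun x hx => hx.1
  have hae := weakFDeriv_ae_eq_of_eqOn hU hV hle fun x hx => hVU x (by obtain ⟨i, hi⟩ := hx.2; exact ⟨i, hi.le⟩)
  have hsub : ({x : EuclideanSpace ℝ (Fin 3) | ∀ i : Fin 3, |x i| < 1} \ {x | ∀ i : Fin 3, |x i| < s₃}) ⊆ (Ω' : Set _) := by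
    intro x hx
    refine ⟨hx.1, ?_⟩
    have h2 : ¬ ∀ i : Fin 3, |x i| < s₃ := hx.2
    push Not at h2
    obtain ⟨i, hi⟩ := h2
    exact ⟨i, hs.trans_le hi⟩
  have := ae_restrict_of_ae_restrict_of_subset hsub hae
  filter_upwards [this] with x hx
  simp only [hx]

/-! ## §3 The outer identity on the cube -/

/-- ★ **THE OUTER IDENTITY.**  If two integrable functions on `Q` agree a.e. off `Q_{s₃}` (`s₃ ≤ 1`) and compare on `Q_{s₃}`, they compare on `Q`. [folklore] -/
theorem setIntegral_cube_le_of_inner_le {f g : EuclideanSpace ℝ (Fin 3) → ℝ}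
    (hf : IntegrableOn f {x : EuclideanSpace ℝ (Fin 3) | ∀ i : Fin 3, |x i| < 1} volume)
    (hg : IntegrableOn g {x : EuclideanSpace ℝ (Fin 3) | ∀ i : Fin 3, |x i| < 1} volume)
    {s₃ : ℝ} (hs₃ : s₃ ≤ 1)
    (hout : ∀ᵐ x ∂(volume.restrict ({x : EuclideanSpace ℝ (Fin 3) | ∀ i : Fin 3, |x i| < 1} \ {x | ∀ i : Fin 3, |x i| < s₃})), g x = f x)
    (hin : ∫ x in {x : EuclideanSpace ℝ (Fin 3) | ∀ i : Fin 3, |x i| < s₃}, f x ≤ ∫ x in {x : EuclideanSpace ℝ (Fin 3) | ∀ i : Fin 3, |x i| < s₃}, g x) :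
    ∫ x in {x : EuclideanSpace ℝ (Fin 3) | ∀ i : Fin 3, |x i| < 1}, f x ≤ ∫ x in {x : EuclideanSpace ℝ (Fin 3) | ∀ i : Fin 3, |x i| < 1}, g x := by
  have hinter : {x : EuclideanSpace ℝ (Fin 3) | ∀ i : Fin 3, |x i| < 1} ∩ {x | ∀ i : Fin 3, |x i| < s₃} = {x | ∀ i : Fin 3, |x i| < s₃} := by
    ext x
    simp only [Set.mem_inter_iff, Set.mem_setOf_eq, and_iff_right_iff_imp]
    exact fun h i => (h i).trans_le hs₃
  rw [← integral_inter_add_sdiff (isOpen_absCube s₃).measurableSet hf, ← integral_inter_add_sdiff (isOpen_absCube s₃).measurableSet hg, hinter]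
  have hout' : ∫ x in {x : EuclideanSpace ℝ (Fin 3) | ∀ i : Fin 3, |x i| < 1} \ {x | ∀ i : Fin 3, |x i| < s₃}, g x
      = ∫ x in {x : EuclideanSpace ℝ (Fin 3) | ∀ i : Fin 3, |x i| < 1} \ {x | ∀ i : Fin 3, |x i| < s₃}, f x := integral_congr_ae hout
  rw [hout']
  linarith

/-! ## §4 The monotone limit in the radius -/

/-- ★ **A BOUND ON ALL INNER CUBES IS A BOUND ON THE CUBE.**  If `f` is integrable on `Q_{s₃}` and `∫_{Q_{s₁}} f ≤ B` for all `s₀ < s₁ < s₃`, then `∫_{Q_{s₃}} f ≤ B`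
(`Q_{s₁} ↑ Q_{s₃}`, continuity of the integral along a monotone union — Mathlib `tendsto_setIntegral_of_monotone`). [folklore] -/
theorem setIntegral_absCube_le_of_forall_lt {f : EuclideanSpace ℝ (Fin 3) → ℝ} {s₀ s₃ B : ℝ} (hs : s₀ < s₃)
    (hf : IntegrableOn f {x : EuclideanSpace ℝ (Fin 3) | ∀ i : Fin 3, |x i| < s₃} volume)
    (h : ∀ s₁ : ℝ, s₀ < s₁ → s₁ < s₃ → ∫ x in {x : EuclideanSpace ℝ (Fin 3) | ∀ i : Fin 3, |x i| < s₁}, f x ≤ B) :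
    ∫ x in {x : EuclideanSpace ℝ (Fin 3) | ∀ i : Fin 3, |x i| < s₃}, f x ≤ B := by
  -- the radii `s n := s₃ − (s₃ − s₀)/(n+2)` increase to `s₃` inside `(s₀, s₃)`
  set r : ℕ → ℝ := fun n => s₃ - (s₃ - s₀) / ((n : ℝ) + 2) with hr
  have hr_lt : ∀ n, r n < s₃ := fun n => by
    have : 0 < (s₃ - s₀) / ((n : ℝ) + 2) := by positivity
    simp only [hr]; linarith
  have hr_gt : ∀ n, s₀ < r n := fun n => by
    simp only [hr]
    have h2 : (1 : ℝ) < (n : ℝ) + 2 := by have := (Nat.cast_nonneg n : (0:ℝ) ≤ n); linarith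
    have : (s₃ - s₀) / ((n : ℝ) + 2) < s₃ - s₀ := by
      rw [div_lt_iff₀ (by positivity)]; nlinarith
    linarith
  have hr_mono : Monotone r := by
    intro m n hmn
    simp only [hr]
    have hmn' : (m : ℝ) + 2 ≤ (n : ℝ) + 2 := by have := (Nat.cast_le.2 hmn : (m : ℝ) ≤ n); linarith
    have : (s₃ - s₀) / ((n : ℝ) + 2) ≤ (s₃ - s₀) / ((m : ℝ) + 2) :=
      div_le_div_of_nonneg_left (by linarith) (by positivity) hmn'
    linarith
  have hr_tend : Tendsto r atTop (𝓝 s₃) := by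
    have h1 : Tendsto (fun n : ℕ => (s₃ - s₀) / ((n : ℝ) + 2)) atTop (𝓝 0) := by
      have h2 : Tendsto (fun n : ℕ => ((n : ℝ) + 2)) atTop atTop := tendsto_natCast_atTop_atTop.atTop_add tendsto_const_nhds
      exact tendsto_const_nhds.div_atTop h2
    have h3 : Tendsto (fun n : ℕ => s₃ - (s₃ - s₀) / ((n : ℝ) + 2)) atTop (𝓝 (s₃ - 0)) :=
      (tendsto_const_nhds (x := s₃)).sub h1
    rw [sub_zero] at h3
    exact h3
  -- the cubes
  set S : ℕ → Set (EuclideanSpace ℝ (Fin 3)) := fun n => {x | ∀ i : Fin 3, |x i| < r n} with hS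
  have hSm : ∀ n, MeasurableSet (S n) := fun n => (isOpen_absCube (r n)).measurableSet
  have hSmono : Monotone S := fun m n hmn x hx i => (hx i).trans_le (hr_mono hmn)
  have hU : (⋃ n, S n) = {x : EuclideanSpace ℝ (Fin 3) | ∀ i : Fin 3, |x i| < s₃} := by
    ext x
    simp only [Set.mem_iUnion, Set.mem_setOf_eq, hS]
    constructor
    · rintro ⟨n, hn⟩ i; exact (hn i).trans (hr_lt n)
    · intro hx
      have hev : ∀ i : Fin 3, ∀ᶠ n in atTop, |x i| < r n := fun i => hr_tend.eventually (eventually_gt_nhds (hx i))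
      obtain ⟨n, hn⟩ := (eventually_all.2 hev).exists
      exact ⟨n, hn⟩
  have hfi : IntegrableOn f (⋃ n, S n) volume := by rw [hU]; exact hf
  have ht := tendsto_setIntegral_of_monotone hSm hSmono hfi
  rw [hU] at ht
  exact le_of_tendsto' ht fun n => h (r n) (hr_gt n) (hr_lt n)

/-! ## §5 Integrability letters for the competitor side -/

/-- A map with a weak gradient on `Q` is a.e.-strongly measurable on `Q`. [cite: Evans2010, §5.2.1] -/
theorem aestronglyMeasurable_of_hasWeakFDerivOn {Ω : Opens (EuclideanSpace ℝ (Fin 3))}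
    {V : EuclideanSpace ℝ (Fin 3) → EuclideanSpace ℝ (Fin 4)} {GV : EuclideanSpace ℝ (Fin 3) → (EuclideanSpace ℝ (Fin 3) →L[ℝ] EuclideanSpace ℝ (Fin 4))}
    (hV : HasWeakFDerivOn Ω volume V GV) : AEStronglyMeasurable V (volume.restrict (Ω : Set _)) :=
  hV.locallyIntegrableOn.aestronglyMeasurable

/-- On a set of finite measure, `x ↦ ‖a x − b x‖²` with `a` measurable, `b` a.e.-strongly measurable and both pointwise bounded in norm by `1` is integrable.
[folklore] -/
theorem integrableOn_normSq_sub_of_bound {A : Set (EuclideanSpace ℝ (Fin 3))} (hA : volume A < ⊤)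
    {a b : EuclideanSpace ℝ (Fin 3) → EuclideanSpace ℝ (Fin 4)}
    (ha : AEStronglyMeasurable a (volume.restrict A)) (hb : AEStronglyMeasurable b (volume.restrict A))
    (ha1 : ∀ x, ‖a x‖ ≤ 1) (hb1 : ∀ᵐ x ∂(volume.restrict A), ‖b x‖ ≤ 1) :
    IntegrableOn (fun x => ‖a x - b x‖ ^ 2) A volume := by
  haveI : IsFiniteMeasure (volume.restrict A) := ⟨by rwa [Measure.restrict_apply_univ]⟩
  refine ⟨((ha.sub hb).norm.pow 2), ?_⟩
  refine HasFiniteIntegral.of_bounded (C := 4) ?_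
  filter_upwards [hb1] with x hx
  rw [Real.norm_eq_abs, abs_of_nonneg (by positivity)]
  have : ‖a x - b x‖ ≤ 2 := (norm_sub_le _ _).trans (by linarith [ha1 x])
  nlinarith [norm_nonneg (a x - b x)]

end Summit.QuantumFields.YangMills.Theorems.PoincareLipschitzLatticeToContinuumSobolevLetters

end
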